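import Summits.NavierStokesRegularity.NavierStokesRegularity.Theorems.RungBlowupCofinal.ToroidalLift
import Summits.NavierStokesRegularity.NavierStokesRegularity.Theorems.RungBlowupCofinal.SectoralHarmonics
import Summits.NavierStokesRegularity.NavierStokesRegularity.Theorems.RungBlowupCofinal.Negative.MeanWaveFoldRange
import Summits.NavierStokesRegularity.FluidComputer.AngularGalerkinLadderDivergence
import Summits.NavierStokesRegularity.FluidComputer.AngularGalerkinLadderLinearFlows
import HarnessLib

/-!
# Solid-harmonic lifts on the angular Galerkin ladder: the scalar Casimir is the angular
# Laplacian, solid harmonics of degree `j` are its `j(j+1)`-eigenfunctions, and their three lifts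
# `∇φ`, `φ(x)x`, `x × ∇φ(x)` are band-limited of degree `j` and co-band-limited of every degree `< j`
# (route `AngularGalerkinLadder`, crux K1 `RungBlowupCofinal`; kinematic helper, theorems only)

Cell `ns-blowup`, seat `ns-blowup-circuit` (g11, AGL Lean seat). Helper file for
`stmt-NavierStokesRegularity-19959` serving the line `Cruxes/RungBlowupCofinal/Lines/qlwave.lean`:
its card (§1–§2 «Hardest stub») reduces every fixed rung of the mean–wave system to a RADIAL
boundary-value problem whose unknowns are the radial coefficients of vector spherical harmonics —
for the zonal part `V` the lifts of the zonal solid harmonics (`j ≤ L`, `m = 0`), for the sectoral wave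
`W` the three lifts of `Re/Im (y₀ + iy₁)^L`. This file types the mechanism by which such explicit
ansätze enter the projection-free letters of the vocabulary: `IsBandLimited` (for the profiles) and
`IsCobandLimited` (for the defects). Companion files: `ToroidalLift.lean`, `SectoralHarmonics.lean`,
`SectoralToroidalWaves.lean` (FIRST PROVER TARGET (S1), landed). LABEL: KERNEL kinematics. Nothing
here asserts a Theses declaration; no definition, no named fact. WHAT THIS IS NOT: not Navier–Stokes
evidence; not a profile — calculus identities for smooth scalar fields on `ℝ³` and their lifts.

## Content

Scalar rotation derivatives are written, as in the tree's `angGen_gradient` / `casimir_gradient`,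
as `K_a φ = (y ↦ −Dφ(y)(e_a × y))`, and the scalar Casimir as `−Σ_a K_aK_a φ`.

* §1 **`scalarCasimir_eq`**: `−Σ_a K_aK_a φ (y) = −‖y‖² Δφ(y) + D²φ(y)(y, y) + 2 Dφ(y) y` — the
  angular-momentum identity `L² = −r²Δ + (y·∇)² + y·∇` (via the trace identity
  `Σ_a B(e_a × y, e_a × y) = ‖y‖² tr B − B(y, y)`, `sum_bilin_crossCLM_axis`);
  `fderiv_fderiv_self_of_homogeneous` (Euler: `Dφ(y)y = jφ ⇒ D²φ(y,y) = j(j−1)φ`);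
  **`scalarCasimir_of_harmonic_homogeneous`**: `Δφ = 0`, `Dφ(y)y = jφ(y)` ⇒ `−Σ_a K_aK_aφ = j(j+1)φ`.
* §2 **`isBandLimited_of_casimir_eq_smul`** (a smooth `𝒞`-eigenfield of eigenvalue `j(j+1)` is
  band-limited of every degree `L ≥ j`), **`isCobandLimited_of_casimir_eq_smul`** (a smooth
  `𝒞`-eigenfield whose eigenvalue is no `k(k+1)`, `k ≤ L`, is CO-band-limited of degree `L` — no
  growth or support hypothesis; symmetry of the band defect, tree `integral_inner_bandDefect_comm`),
  `isCobandLimited_of_casimir_eq_smul_of_lt` (eigenvalue `j(j+1)`, `j > L`),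
  `casimir_radial_smul_of_eq_smul` (radial profiles preserve eigenfields).
* §3 the three lifts: `casimir_gradient_of_scalarCasimir` (GRADIENT, tree `casimir_gradient`),
  **`angGen_smulSelf`** / `casimir_smulSelf` / `casimir_smulSelf_of_scalarCasimir` (RADIAL lift
  `x ↦ φ(x)x`: `J_a(φ x) = (K_aφ) x`), `casimir_crossSelf_gradient_of_scalarCasimir` (TOROIDAL,
  via `ToroidalLift`).
* §4 solid harmonics of degree `j`: `casimir_{gradient,smulSelf,crossSelf_gradient}_of_solidHarmonic`
  (`𝒞 = j(j+1)` on all three lifts), **`isBandLimited_{…}_of_solidHarmonic`** (`L ≥ j`),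
  **`isCobandLimited_radial_{…}_of_solidHarmonic`** (`L < j`, any smooth radial profile `χ(‖x‖²)`).

[cite: BullardGellman1954] (vector spherical harmonics `f(r)∇(r^jY)`, `g(r) r^jY x̂`,
`h(r) x × ∇(r^jY)` as the degree-`j` isotype; `L²(r^jY_{jm}) = j(j+1) r^jY_{jm}`; here projection-free,
in the tree's Casimir-cut typing).
-/

noncomputable section


namespace Summit.NavierStokesRegularity.AngularGalerkinLadderSolidHarmonicLifts

open Set Function MeasureTheory
open scoped ContDiff RealInnerProductSpace Laplacian
open Literature.Analysis.FluidPDE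
open Summit.NavierStokesRegularity.FluidComputer
open Summit.NavierStokesRegularity.FluidComputer.AngularLadder
open Summit.NavierStokesRegularity.AngularGalerkinLadderToroidalLift
open Summit.NavierStokesRegularity.AngularGalerkinLadderSectoralHarmonics

variable {φ : EuclideanSpace ℝ (Fin 3) → ℝ} {u : EuclideanSpace ℝ (Fin 3) → EuclideanSpace ℝ (Fin 3)}
  {L : ℕ}

/-! ## §1 The scalar Casimir is the angular Laplacian:
`−Σ_a K_aK_a φ = −‖y‖² Δφ + D²φ(y, y) + 2 Dφ(y) y` -/

/-- `Σ_i v_i e_i = v`. [folklore] -/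
private theorem sum_smul_axis (v : EuclideanSpace ℝ (Fin 3)) : ∑ i : Fin 3, v i • axis i = v := by
  apply PiLp.ext
  intro j
  fin_cases j <;> simp [Fin.sum_univ_three, axis_apply]

/-- Bilinear expansion in the axes: `B v w = Σ_i Σ_j v_i w_j B(e_i)(e_j)`. [folklore] -/
private theorem bilin_eq_sum (B : EuclideanSpace ℝ (Fin 3) →L[ℝ] EuclideanSpace ℝ (Fin 3) →L[ℝ] ℝ)
    (v w : EuclideanSpace ℝ (Fin 3)) :
    B v w = ∑ i : Fin 3, ∑ j : Fin 3, v i * w j * B (axis i) (axis j) := by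
  have hv : B v w = ∑ i : Fin 3, v i * B (axis i) w := by
    conv_lhs => rw [← sum_smul_axis v]
    simp only [map_sum, map_smul, FunLike.coe_sum, Finset.sum_apply, FunLike.coe_smul,
      Pi.smul_apply, smul_eq_mul]
  have hw : ∀ i : Fin 3, B (axis i) w = ∑ j : Fin 3, w j * B (axis i) (axis j) := fun i => by
    conv_lhs => rw [← sum_smul_axis w]
    simp only [map_sum, map_smul, smul_eq_mul]
  rw [hv]
  refine Finset.sum_congr rfl fun i _ => ?_
  rw [hw i, Finset.mul_sum]
  refine Finset.sum_congr rfl fun j _ => ?_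
  ring

/-- **The trace identity behind the angular Laplacian**: for every bilinear form `B` on `ℝ³`,
`Σ_a B(e_a × y, e_a × y) = ‖y‖² Σ_i B(e_i, e_i) − B(y, y)` (`Σ_a (e_a × y)(e_a × y)ᵀ = ‖y‖²I − yyᵀ`).
[folklore] -/
theorem sum_bilin_crossCLM_axis
    (B : EuclideanSpace ℝ (Fin 3) →L[ℝ] EuclideanSpace ℝ (Fin 3) →L[ℝ] ℝ)
    (y : EuclideanSpace ℝ (Fin 3)) :
    ∑ a : Fin 3, B (crossCLM (axis a) y) (crossCLM (axis a) y) =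
      ‖y‖ ^ 2 * (∑ i : Fin 3, B (axis i) (axis i)) - B y y := by
  have hn : ‖y‖ ^ 2 = ∑ i : Fin 3, y i * y i := by
    rw [EuclideanSpace.norm_sq_eq]
    refine Finset.sum_congr rfl fun i _ => ?_
    rw [Real.norm_eq_abs, sq_abs, sq]
  rw [hn, Fin.sum_univ_three, bilin_eq_sum B (crossCLM (axis 0) y), bilin_eq_sum B (crossCLM (axis 1) y),
    bilin_eq_sum B (crossCLM (axis 2) y), bilin_eq_sum B y y]
  simp only [Fin.sum_univ_three, crossCLM_apply, cross, cross_apply, axis_apply,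
    PiLp.toLp_apply, Matrix.cons_val_zero, Matrix.cons_val_one, Matrix.cons_val_two,
    Matrix.head_cons, Matrix.tail_cons]
  simp
  ring

/-- The Laplacian as the trace of the second derivative in the axes:
`Δφ(y) = Σ_i D²φ(y)(e_i)(e_i)`. [folklore] -/
private theorem laplacian_eq_sum_axis (φ : EuclideanSpace ℝ (Fin 3) → ℝ) (y : EuclideanSpace ℝ (Fin 3)) :
    (Δ φ) y = ∑ i : Fin 3, fderiv ℝ (fderiv ℝ φ) y (axis i) (axis i) := by
  rw [InnerProductSpace.laplacian_eq_iteratedFDeriv_orthonormalBasis φ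
    (EuclideanSpace.basisFun (Fin 3) ℝ)]
  refine Finset.sum_congr rfl fun i _ => ?_
  rw [iteratedFDeriv_two_apply]
  simp [axis]

/-- `K_aK_aφ(y) = D²φ(y)(e_a × y, e_a × y) + Dφ(y)(e_a × (e_a × y))` (Leibniz rule for the derivative
along a linear field, tree `fderiv_fderiv_apply_clm`). [folklore] -/
theorem scalarRot_scalarRot_apply (hφ : ContDiff ℝ ∞ φ) (a : Fin 3) (y : EuclideanSpace ℝ (Fin 3)) :
    -fderiv ℝ (fun z => -fderiv ℝ φ z (crossCLM (axis a) z)) y (crossCLM (axis a) y) =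
      fderiv ℝ (fderiv ℝ φ) y (crossCLM (axis a) y) (crossCLM (axis a) y) +
        fderiv ℝ φ y (crossCLM (axis a) (crossCLM (axis a) y)) := by
  rw [fderiv_fun_neg, _root_.neg_apply, neg_neg,
    fderiv_fderiv_apply_clm hφ (crossCLM (axis a)) y (crossCLM (axis a) y)]

/-- **The scalar Casimir is the angular Laplacian** (`L² = −r²Δ + (y·∇)² + y·∇`): for smooth `φ`,
`−Σ_a K_aK_a φ(y) = −‖y‖² Δφ(y) + D²φ(y)(y)(y) + 2 Dφ(y) y`, in the letters of the tree's
`casimir_gradient`. [folklore] -/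
theorem scalarCasimir_eq (hφ : ContDiff ℝ ∞ φ) (y : EuclideanSpace ℝ (Fin 3)) :
    -∑ a : Fin 3, -fderiv ℝ (fun z => -fderiv ℝ φ z (crossCLM (axis a) z)) y (crossCLM (axis a) y) =
      -(‖y‖ ^ 2 * (Δ φ) y) + fderiv ℝ (fderiv ℝ φ) y y y + 2 * fderiv ℝ φ y y := by
  have h1 : ∀ a : Fin 3, -fderiv ℝ (fun z => -fderiv ℝ φ z (crossCLM (axis a) z)) y
      (crossCLM (axis a) y) = fderiv ℝ (fderiv ℝ φ) y (crossCLM (axis a) y) (crossCLM (axis a) y) +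
        fderiv ℝ φ y (crossCLM (axis a) (crossCLM (axis a) y)) :=
    fun a => scalarRot_scalarRot_apply hφ a y
  have h2 : ∑ a : Fin 3, -fderiv ℝ (fun z => -fderiv ℝ φ z (crossCLM (axis a) z)) y
      (crossCLM (axis a) y) = ∑ a : Fin 3, (fderiv ℝ (fderiv ℝ φ) y (crossCLM (axis a) y)
        (crossCLM (axis a) y) + fderiv ℝ φ y (crossCLM (axis a) (crossCLM (axis a) y))) :=
    Finset.sum_congr rfl fun a _ => h1 a
  rw [h2, Finset.sum_add_distrib, sum_bilin_crossCLM_axis, ← map_sum, sum_crossCLM_crossCLM_axis y,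
    laplacian_eq_sum_axis φ y, map_neg, map_smul, smul_eq_mul]
  ring

/-- **Euler's identity differentiated**: if `Dφ(y) y = j φ(y)` for all `y` (homogeneity of degree
`j`) then `D²φ(y)(y)(y) = j(j−1) φ(y)`. [folklore] -/
theorem fderiv_fderiv_self_of_homogeneous (hφ : ContDiff ℝ ∞ φ) {j : ℝ}
    (hE : ∀ y, fderiv ℝ φ y y = j * φ y) (y : EuclideanSpace ℝ (Fin 3)) :
    fderiv ℝ (fderiv ℝ φ) y y y = j * (j - 1) * φ y := by
  have h1 := fderiv_fderiv_apply_clm hφ (ContinuousLinearMap.id ℝ _) y y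
  simp only [ContinuousLinearMap.coe_id', id] at h1
  have h2 : (fun z => fderiv ℝ φ z z) = fun z => j * φ z := funext hE
  rw [h2, fderiv_const_mul ((hφ.differentiable (by simp)) y), FunLike.coe_smul,
    Pi.smul_apply, smul_eq_mul, hE y] at h1
  linarith [h1]

/-- **Solid harmonics are eigenfunctions of the scalar Casimir**: a smooth `φ` with `Δφ = 0` and
`Dφ(y) y = j φ(y)` (harmonic, homogeneous of degree `j`) satisfies `−Σ_a K_aK_a φ = j(j+1) φ`.
[cite: BullardGellman1954] (`L² r^j Y_{jm} = j(j+1) r^j Y_{jm}`; here projection-free). -/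
theorem scalarCasimir_of_harmonic_homogeneous (hφ : ContDiff ℝ ∞ φ) (hΔ : ∀ y, (Δ φ) y = 0) {j : ℝ}
    (hE : ∀ y, fderiv ℝ φ y y = j * φ y) (y : EuclideanSpace ℝ (Fin 3)) :
    -∑ a : Fin 3, -fderiv ℝ (fun z => -fderiv ℝ φ z (crossCLM (axis a) z)) y (crossCLM (axis a) y) =
      (j * (j + 1)) * φ y := by
  rw [scalarCasimir_eq hφ y, hΔ y, fderiv_fderiv_self_of_homogeneous hφ hE y, hE y]
  ring

/-! ## §2 Casimir eigenfields: band-limited at their own degree, co-band-limited below it -/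

/-- **A smooth `𝒞`-eigenfield of eigenvalue `j(j+1)` is band-limited of every degree `L ≥ j`**
(the degree-`L` band defect carries the vanishing factor `j`). [folklore] -/
theorem isBandLimited_of_casimir_eq_smul (hu : ContDiff ℝ ∞ u) {j : ℕ}
    (hμ : casimir u = ((j : ℝ) * ((j : ℝ) + 1)) • u) (hjL : j ≤ L) : IsBandLimited L u := by
  refine ⟨hu, fun y => ?_⟩
  rw [AngularGalerkinLadderMeanWaveFoldRange.bandDefect_eq_smul_of_casimir_eq hu hμ L, Pi.smul_apply]
  have h0 : (∏ k ∈ Finset.range (L + 1), ((j : ℝ) * ((j : ℝ) + 1) - (k : ℝ) * ((k : ℝ) + 1))) = 0 :=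
    Finset.prod_eq_zero (Finset.mem_range.2 (Nat.lt_succ_of_le hjL)) (sub_self _)
  rw [h0, zero_smul]

/-- **A smooth `𝒞`-eigenfield whose eigenvalue is none of `j(j+1)`, `j ≤ L`, is co-band-limited of
degree `L`**: the degree-`L` band defect acts on it by a non-zero scalar and is symmetric on `L²`
(tree `integral_inner_bandDefect_comm`). No growth or support hypothesis on the field. [folklore] -/
theorem isCobandLimited_of_casimir_eq_smul (hu : ContDiff ℝ ∞ u) {μ : ℝ} (hμ : casimir u = μ • u)
    (hne : ∀ j : ℕ, j ≤ L → μ ≠ (j : ℝ) * ((j : ℝ) + 1)) : IsCobandLimited L u := by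
  intro ψ hψ hψc
  have hp : (∏ k ∈ Finset.range (L + 1), (μ - (k : ℝ) * ((k : ℝ) + 1))) ≠ 0 := by
    rw [Finset.prod_ne_zero_iff]
    intro k hk
    exact sub_ne_zero.2 (hne k (Nat.lt_succ_iff.1 (Finset.mem_range.1 hk)))
  have hcomm := integral_inner_bandDefect_comm hu L hψ.1 hψc
  have h0 : ∀ x, bandDefect L ψ x = 0 := hψ.2
  simp only [h0, inner_zero_right, integral_zero,
    AngularGalerkinLadderMeanWaveFoldRange.bandDefect_eq_smul_of_casimir_eq hu hμ L, Pi.smul_apply,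
    real_inner_smul_left] at hcomm
  rw [integral_const_mul] at hcomm
  exact (mul_eq_zero.1 hcomm).resolve_left hp

/-- **An eigenfield of degree `j > L` is co-band-limited of degree `L`** (`j(j+1) ≠ k(k+1)` for
`k ≤ L < j`). [folklore] -/
theorem isCobandLimited_of_casimir_eq_smul_of_lt (hu : ContDiff ℝ ∞ u) {j : ℕ}
    (hμ : casimir u = ((j : ℝ) * ((j : ℝ) + 1)) • u) (hLj : L < j) : IsCobandLimited L u := by
  refine isCobandLimited_of_casimir_eq_smul hu hμ fun k hk h => ?_
  have hkj : (k : ℝ) < j := by exact_mod_cast lt_of_le_of_lt hk hLj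
  have hk0 : (0 : ℝ) ≤ k := Nat.cast_nonneg k
  nlinarith

/-- Radial multipliers preserve `𝒞`-eigenfields. [folklore] -/
theorem casimir_radial_smul_of_eq_smul {χ : ℝ → ℝ} (hχ : ContDiff ℝ ∞ χ) (hu : ContDiff ℝ ∞ u)
    {μ : ℝ} (hμ : casimir u = μ • u) :
    casimir (fun x : EuclideanSpace ℝ (Fin 3) => χ (‖x‖ ^ 2) • u x) =
      μ • fun x : EuclideanSpace ℝ (Fin 3) => χ (‖x‖ ^ 2) • u x := by
  rw [casimir_radial_smul hχ hu, hμ]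
  funext x
  simp only [Pi.smul_apply, smul_comm (χ (‖x‖ ^ 2))]

/-! ## §3 The three lifts of a scalar: gradient `∇φ`, radial `φ(x) x`, toroidal `x × ∇φ(x)` -/

/-- `∇(c φ) = c ∇φ`. [folklore] -/
private theorem gradient_const_mul' (hφ : Differentiable ℝ φ) (c : ℝ) :
    gradient (fun y => c * φ y) = fun y => c • gradient φ y := by
  funext y
  refine ext_inner_right ℝ fun w => ?_
  rw [inner_gradient_left, real_inner_smul_left, inner_gradient_left, fderiv_const_mul (hφ y) c]
  simp only [FunLike.coe_smul, Pi.smul_apply, smul_eq_mul]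

/-- The gradient field of a smooth function is smooth. [folklore] -/
private theorem contDiff_gradient' (hφ : ContDiff ℝ ∞ φ) : ContDiff ℝ ∞ (gradient φ) := by
  set Lr : (EuclideanSpace ℝ (Fin 3) →L[ℝ] ℝ) →L[ℝ] EuclideanSpace ℝ (Fin 3) :=
    (InnerProductSpace.toDual ℝ (EuclideanSpace ℝ (Fin 3))).symm.toContinuousLinearEquiv.toContinuousLinearMap
    with hLr
  have h1 : gradient φ = fun y => Lr (fderiv ℝ φ y) := rfl
  rw [h1]
  exact Lr.contDiff.comp (contDiff_infty_iff_fderiv.1 hφ).2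

/-- **GRADIENT LIFT**: if `−Σ_a K_aK_a φ = μ φ` then `𝒞(∇φ) = μ ∇φ` (tree `casimir_gradient`).
[folklore] -/
theorem casimir_gradient_of_scalarCasimir (hφ : ContDiff ℝ ∞ φ) {μ : ℝ}
    (hC : ∀ y, -∑ a : Fin 3, -fderiv ℝ (fun z => -fderiv ℝ φ z (crossCLM (axis a) z)) y
      (crossCLM (axis a) y) = μ * φ y) :
    casimir (gradient φ) = μ • gradient φ := by
  rw [casimir_gradient hφ, show (fun y => -∑ a : Fin 3, -fderiv ℝ (fun z => -fderiv ℝ φ z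
      (crossCLM (axis a) z)) y (crossCLM (axis a) y)) = fun y => μ * φ y from funext hC,
    gradient_const_mul' (hφ.differentiable (by simp))]
  rfl

/-- **RADIAL LIFT commutes with the generators**: `J_a (x ↦ φ(x) x) = x ↦ (K_aφ)(x) x` with
`K_aφ = −Dφ(·)(e_a × ·)` (the terms `φ e_a × x` cancel). [folklore] -/
theorem angGen_smulSelf (hφ : Differentiable ℝ φ) (a : Fin 3) :
    angGen a (fun x : EuclideanSpace ℝ (Fin 3) => φ x • x) =
      fun x => (-fderiv ℝ φ x (crossCLM (axis a) x)) • x := by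
  funext x
  have hd : HasFDerivAt (fun y : EuclideanSpace ℝ (Fin 3) => φ y • y)
      (φ x • ContinuousLinearMap.id ℝ _ + (fderiv ℝ φ x).smulRight x) x :=
    ((hφ x).hasFDerivAt).smul (hasFDerivAt_id x)
  rw [angGen_eq]
  simp only [hd.fderiv, _root_.add_apply, FunLike.coe_smul, Pi.smul_apply,
    ContinuousLinearMap.coe_id', id, ContinuousLinearMap.smulRight_apply, map_smul, neg_smul]
  abel

/-- The radial lift of a smooth scalar is smooth. [folklore] -/
theorem contDiff_smulSelf (hφ : ContDiff ℝ ∞ φ) :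
    ContDiff ℝ ∞ fun x : EuclideanSpace ℝ (Fin 3) => φ x • x :=
  hφ.smul contDiff_id

/-- **RADIAL LIFT**: `𝒞(x ↦ φ(x) x) = x ↦ (−Σ_a K_aK_aφ)(x) x`. [folklore] -/
theorem casimir_smulSelf (hφ : ContDiff ℝ ∞ φ) :
    casimir (fun x : EuclideanSpace ℝ (Fin 3) => φ x • x) = fun x =>
      (-∑ a : Fin 3, -fderiv ℝ (fun z => -fderiv ℝ φ z (crossCLM (axis a) z)) x
        (crossCLM (axis a) x)) • x := by
  funext x
  have hK : ∀ a : Fin 3, ContDiff ℝ ∞ fun z => -fderiv ℝ φ z (crossCLM (axis a) z) :=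
    fun a => (contDiff_fderiv_apply_clm hφ (crossCLM (axis a))).neg
  have h1 : ∀ a : Fin 3, angGen a (angGen a fun y : EuclideanSpace ℝ (Fin 3) => φ y • y) =
      fun y => (-fderiv ℝ (fun z => -fderiv ℝ φ z (crossCLM (axis a) z)) y
        (crossCLM (axis a) y)) • y := fun a => by
    rw [angGen_smulSelf (hφ.differentiable (by simp)) a,
      angGen_smulSelf ((hK a).differentiable (by simp)) a]
  simp only [casimir, h1]
  rw [neg_smul, Finset.sum_smul, ← Finset.sum_neg_distrib]

/-- **RADIAL LIFT of a Casimir eigen-scalar**: if `−Σ_a K_aK_a φ = μ φ` then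
`𝒞(x ↦ φ(x) x) = μ (x ↦ φ(x) x)`. [folklore] -/
theorem casimir_smulSelf_of_scalarCasimir (hφ : ContDiff ℝ ∞ φ) {μ : ℝ}
    (hC : ∀ y, -∑ a : Fin 3, -fderiv ℝ (fun z => -fderiv ℝ φ z (crossCLM (axis a) z)) y
      (crossCLM (axis a) y) = μ * φ y) :
    casimir (fun x : EuclideanSpace ℝ (Fin 3) => φ x • x) =
      μ • fun x : EuclideanSpace ℝ (Fin 3) => φ x • x := by
  rw [casimir_smulSelf hφ]
  funext x
  rw [hC x, Pi.smul_apply, smul_smul]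

/-- **TOROIDAL LIFT of a Casimir eigen-scalar**: `𝒞(x ↦ x × ∇φ(x)) = μ (x ↦ x × ∇φ(x))`.
[folklore] -/
theorem casimir_crossSelf_gradient_of_scalarCasimir (hφ : ContDiff ℝ ∞ φ) {μ : ℝ}
    (hC : ∀ y, -∑ a : Fin 3, -fderiv ℝ (fun z => -fderiv ℝ φ z (crossCLM (axis a) z)) y
      (crossCLM (axis a) y) = μ * φ y) :
    casimir (fun x => cross x (gradient φ x)) = μ • fun x => cross x (gradient φ x) :=
  casimir_crossSelf_of_eq_smul (contDiff_gradient' hφ) (casimir_gradient_of_scalarCasimir hφ hC)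

/-! ## §4 Solid harmonics of degree `j`: all three lifts are band-limited of degree `j` and
co-band-limited of every degree `< j` -/

section SolidHarmonic

variable {j : ℕ}

/-- The three lifts of a solid harmonic of degree `j` (`Δφ = 0`, `Dφ(y)y = jφ(y)`) are
`𝒞`-eigenfields of eigenvalue `j(j+1)`: gradient. [cite: BullardGellman1954] -/
theorem casimir_gradient_of_solidHarmonic (hφ : ContDiff ℝ ∞ φ) (hΔ : ∀ y, (Δ φ) y = 0)
    (hE : ∀ y, fderiv ℝ φ y y = (j : ℝ) * φ y) :
    casimir (gradient φ) = ((j : ℝ) * ((j : ℝ) + 1)) • gradient φ :=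
  casimir_gradient_of_scalarCasimir hφ (scalarCasimir_of_harmonic_homogeneous hφ hΔ hE)

/-- Radial lift of a solid harmonic: `𝒞(φ x) = j(j+1) φ x`. [cite: BullardGellman1954] -/
theorem casimir_smulSelf_of_solidHarmonic (hφ : ContDiff ℝ ∞ φ) (hΔ : ∀ y, (Δ φ) y = 0)
    (hE : ∀ y, fderiv ℝ φ y y = (j : ℝ) * φ y) :
    casimir (fun x : EuclideanSpace ℝ (Fin 3) => φ x • x) =
      ((j : ℝ) * ((j : ℝ) + 1)) • fun x : EuclideanSpace ℝ (Fin 3) => φ x • x :=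
  casimir_smulSelf_of_scalarCasimir hφ (scalarCasimir_of_harmonic_homogeneous hφ hΔ hE)

/-- Toroidal lift of a solid harmonic: `𝒞(x × ∇φ) = j(j+1) x × ∇φ`. [cite: BullardGellman1954] -/
theorem casimir_crossSelf_gradient_of_solidHarmonic (hφ : ContDiff ℝ ∞ φ) (hΔ : ∀ y, (Δ φ) y = 0)
    (hE : ∀ y, fderiv ℝ φ y y = (j : ℝ) * φ y) :
    casimir (fun x => cross x (gradient φ x)) =
      ((j : ℝ) * ((j : ℝ) + 1)) • fun x => cross x (gradient φ x) :=
  casimir_crossSelf_gradient_of_scalarCasimir hφ (scalarCasimir_of_harmonic_homogeneous hφ hΔ hE)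

/-- **The gradient of a solid harmonic of degree `j` is band-limited of degree `≤ L` for every
`L ≥ j`.** [cite: BullardGellman1954] -/
theorem isBandLimited_gradient_of_solidHarmonic (hφ : ContDiff ℝ ∞ φ) (hΔ : ∀ y, (Δ φ) y = 0)
    (hE : ∀ y, fderiv ℝ φ y y = (j : ℝ) * φ y) (hjL : j ≤ L) : IsBandLimited L (gradient φ) :=
  isBandLimited_of_casimir_eq_smul (contDiff_gradient' hφ)
    (casimir_gradient_of_solidHarmonic hφ hΔ hE) hjL

/-- **The radial lift of a solid harmonic of degree `j` is band-limited of degree `≤ L`, `L ≥ j`.**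
[cite: BullardGellman1954] -/
theorem isBandLimited_smulSelf_of_solidHarmonic (hφ : ContDiff ℝ ∞ φ) (hΔ : ∀ y, (Δ φ) y = 0)
    (hE : ∀ y, fderiv ℝ φ y y = (j : ℝ) * φ y) (hjL : j ≤ L) :
    IsBandLimited L fun x : EuclideanSpace ℝ (Fin 3) => φ x • x :=
  isBandLimited_of_casimir_eq_smul (contDiff_smulSelf hφ)
    (casimir_smulSelf_of_solidHarmonic hφ hΔ hE) hjL

/-- **The toroidal lift of a solid harmonic of degree `j` is band-limited of degree `≤ L`, `L ≥ j`.**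
[cite: BullardGellman1954] -/
theorem isBandLimited_crossSelf_gradient_of_solidHarmonic (hφ : ContDiff ℝ ∞ φ)
    (hΔ : ∀ y, (Δ φ) y = 0) (hE : ∀ y, fderiv ℝ φ y y = (j : ℝ) * φ y) (hjL : j ≤ L) :
    IsBandLimited L fun x => cross x (gradient φ x) :=
  isBandLimited_of_casimir_eq_smul (contDiff_crossSelf (contDiff_gradient' hφ))
    (casimir_crossSelf_gradient_of_solidHarmonic hφ hΔ hE) hjL

/-- **Below their degree the lifts are CO-band-limited**: for `L < j` the gradient lift of a solid
harmonic of degree `j`, under any smooth radial profile `χ(‖x‖²)`, is `L²`-orthogonal to every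
compactly supported field band-limited of degree `≤ L` — the letter `IsCobandLimited L` of the rung
defects. [cite: BullardGellman1954] -/
theorem isCobandLimited_radial_gradient_of_solidHarmonic {χ : ℝ → ℝ} (hχ : ContDiff ℝ ∞ χ)
    (hφ : ContDiff ℝ ∞ φ) (hΔ : ∀ y, (Δ φ) y = 0) (hE : ∀ y, fderiv ℝ φ y y = (j : ℝ) * φ y)
    (hLj : L < j) :
    IsCobandLimited L fun x : EuclideanSpace ℝ (Fin 3) => χ (‖x‖ ^ 2) • gradient φ x :=
  isCobandLimited_of_casimir_eq_smul_of_lt (contDiff_radial_smul hχ (contDiff_gradient' hφ))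
    (casimir_radial_smul_of_eq_smul hχ (contDiff_gradient' hφ)
      (casimir_gradient_of_solidHarmonic hφ hΔ hE)) hLj

/-- Co-band-limitedness of the cut-off radial lift below its degree. [cite: BullardGellman1954] -/
theorem isCobandLimited_radial_smulSelf_of_solidHarmonic {χ : ℝ → ℝ} (hχ : ContDiff ℝ ∞ χ)
    (hφ : ContDiff ℝ ∞ φ) (hΔ : ∀ y, (Δ φ) y = 0) (hE : ∀ y, fderiv ℝ φ y y = (j : ℝ) * φ y)
    (hLj : L < j) :
    IsCobandLimited L fun x : EuclideanSpace ℝ (Fin 3) => χ (‖x‖ ^ 2) • (φ x • x) :=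
  isCobandLimited_of_casimir_eq_smul_of_lt (contDiff_radial_smul hχ (contDiff_smulSelf hφ))
    (casimir_radial_smul_of_eq_smul hχ (contDiff_smulSelf hφ)
      (casimir_smulSelf_of_solidHarmonic hφ hΔ hE)) hLj

/-- Co-band-limitedness of the cut-off toroidal lift below its degree. [cite: BullardGellman1954] -/
theorem isCobandLimited_radial_crossSelf_gradient_of_solidHarmonic {χ : ℝ → ℝ}
    (hχ : ContDiff ℝ ∞ χ) (hφ : ContDiff ℝ ∞ φ) (hΔ : ∀ y, (Δ φ) y = 0)
    (hE : ∀ y, fderiv ℝ φ y y = (j : ℝ) * φ y) (hLj : L < j) :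
    IsCobandLimited L fun x : EuclideanSpace ℝ (Fin 3) => χ (‖x‖ ^ 2) • cross x (gradient φ x) :=
  isCobandLimited_of_casimir_eq_smul_of_lt
    (contDiff_radial_smul hχ (contDiff_crossSelf (contDiff_gradient' hφ)))
    (casimir_radial_smul_of_eq_smul hχ (contDiff_crossSelf (contDiff_gradient' hφ))
      (casimir_crossSelf_gradient_of_solidHarmonic hφ hΔ hE)) hLj

end SolidHarmonic

end Summit.NavierStokesRegularity.AngularGalerkinLadderSolidHarmonicLifts

end
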